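import Summits.QuantumFields.BalabanUV.T4Continuum.Support.VariationalVectorRegularityRho
import Summits.QuantumFields.BalabanUV.T4Continuum.Support.VariationalVectorPoincareNear

/-!
# T⁴ programme, spine node NE2 (U1a), lane P2 — leaf V-REG (1-forms), file 7: V-REG FOR THE FEYNMAN–LANDAU FORM ON LINE CARRIERS NEAR A PRODUCT LINE
# (`‖T − lineT T′ R‖ ≤ γ`, the `(E_k)`-near carriers of the taxi ∕ composite towers): (Går) and V-P discharged by leaf-10-g3's near-line rough Poincaré
# (`VariationalVectorPoincareNear.qWV_le_near_line_poincare`, p219305) through leaf-09-g6's `garding_landau` ∕ `qWV_le_of_poincare_divControl`; ONLY V-UB displayed: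
# `rhoV n M R W ≤ (4Λ + ½)·(ScV n M R (landauG 1 R) W + nsqV M φ)` in the classes `2d(nw)² ≤ ½`, `64γ² ≤ 1`, `80·d·(n²p) ≤ 1`
# (model level, `E = ℂ`; cell `pub-balaban`, NE2 formalisation swarm, leaf prover 03 gen 5; asked for by leaf-04-g5's taxi-tower END, CLAIMS.log ≈15:39Z)

HONEST FRAMING (T4-DAG p. 1).  Rung (B)+1 only — NOT infinite volume, NOT a mass gap, NOT Clay.  NE2 is NOT IN PRINT and NOT proved here.  MODEL LEVEL: unitary
site transports `T′`, unitary bond transports `R` (plaquette defect `p`), contractive line-indexed transports `T` at distance `γ` from `lineT T′ R` — all DATA (c5);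
the Landau functional is the tree's only typed inhabitant of the gauge term, NOT Bałaban's `G`.  Composition ([folklore]) of file 3/4's `hREG_rhoV_landau` with
p219305 and p219068; no `def`, no `sorry`; axioms standard.  HONEST DEPENDENCY (cell, verbatim): continuum YM on T⁴ ⇐ BetaPertH ∧ nine spine estimates (0/9
proved); BetaPertH ⇐ (D1) ∧ (D4) ∧ CAP+tail; G-an2-4 gates asym, D1 and NE2/3/4.
-/

noncomputable section

open scoped BigOperators ComplexConjugate ComplexOrder Matrix

namespace Summit.QuantumFields.BalabanUV.T4Continuum.VariationalVectorRegularityNear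

open Finset
open Literature.MathematicalPhysics.QuantumFieldTheory.Balaban1983to89.B5Prop11Plancherel (Tor fine unitVec)
open Literature.MathematicalPhysics.QuantumFieldTheory.Balaban1983to89.B5Blocks16 (blockOf)
open Summit.QuantumFields.BalabanUV.T4Continuum.VariationalColourFederbush (norm_le_one_of_mem_unitary)
open Summit.QuantumFields.BalabanUV.T4Continuum.VariationalVectorFederbush (lineT)
open Summit.QuantumFields.BalabanUV.T4Continuum.VectorBlockTrialForm (nsqV nsqV_nonneg QvL roughV)
open Summit.QuantumFields.BalabanUV.T4Continuum.VariationalVectorForm (ScV qWV ScV_nonneg)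
open Summit.QuantumFields.BalabanUV.T4Continuum.VariationalVectorGarding (landauG landauG_nonneg garding_landau qWV_le_of_poincare_divControl divControl_landauG)
open Summit.QuantumFields.BalabanUV.T4Continuum.VariationalVectorOneStepPhys (rhoV)
open Summit.QuantumFields.BalabanUV.T4Continuum.VariationalVectorPoincareNear (qWV_le_near_line_poincare)
open Summit.QuantumFields.BalabanUV.T4Continuum.VariationalVectorRegularityRho (hREG_rhoV_landau)

variable {d : ℕ} (n : ℕ) [NeZero n] (M : Fin d → ℕ) [hM : ∀ μ, NeZero (M μ)]

/-- **LEAF V-REG FOR THE FEYNMAN–LANDAU FORM ON LINE CARRIERS NEAR A PRODUCT LINE** (model level, `E = ℂ`): contractive line transports `T` with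
`‖T − lineT T′ R‖ ≤ γ`, `64γ² ≤ 1`; unitary `T′`, `R` with in-block defect `w` (`2d(nw)² ≤ ½`) and plaquette defect `p` (`80·d·(n²p) ≤ 1`); V-UB (`Λ`) displayed:
for every datum `φ` and every constrained minimiser `W` of `ScV n M R (landauG 1 R)` on `{QvL T · = φ}`, `rhoV n M R W ≤ (4Λ + ½)·(ScV n M R (landauG 1 R) W + nsqV M φ)`.
[folklore] -/
theorem hREG_rhoV_landau_near {R : Tor (fine n M) → Fin d → (ℂ →L[ℂ] ℂ)} (hU : ∀ x μ, R x μ ∈ unitary (ℂ →L[ℂ] ℂ))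
    {T' : Tor (fine n M) → (ℂ →L[ℂ] ℂ)} (hT' : ∀ x, T' x ∈ unitary (ℂ →L[ℂ] ℂ)) {w : ℝ}
    (hw : ∀ (x : Tor (fine n M)) (μ : Fin d), blockOf n M (x + unitVec (fine n M) μ) = blockOf n M x →
      ‖R x μ * star (T' (x + unitVec (fine n M) μ)) * T' x - 1‖ ≤ w)
    (hsmallw : 2 * (d : ℝ) * ((n : ℝ) * w) ^ 2 ≤ 1 / 2) {p : ℝ} (hp : 0 ≤ p)
    (hP : ∀ x μ ν, ‖R x μ * R (x + unitVec (fine n M) μ) ν - R x ν * R (x + unitVec (fine n M) ν) μ‖ ≤ p)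
    (hsmallp : 80 * (d * ((n : ℝ) ^ 2 * p)) ≤ 1)
    {T : Tor M → (Fin d → Fin n) → Fin n → Fin d → (ℂ →L[ℂ] ℂ)} (hT : ∀ y j t μ, ‖T y j t μ‖ ≤ 1) {γ : ℝ}
    (hnear : ∀ y j t μ, ‖T y j t μ - lineT n M T' R y j t μ‖ ≤ γ) (hγs : 64 * γ ^ 2 ≤ 1) {Λ : ℝ} (hΛ : 0 ≤ Λ)
    (hUBc : ∀ φ : Tor M → Fin d → ℂ, ∃ W, QvL n M T W = φ ∧ ScV n M R (landauG (fine n M) 1 R) W ≤ Λ * nsqV M φ) :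
    ∀ (φ : Tor M → Fin d → ℂ) (W : Tor (fine n M) → Fin d → ℂ), QvL n M T W = φ →
      (∀ W₂, QvL n M T W₂ = φ → ScV n M R (landauG (fine n M) 1 R) W ≤ ScV n M R (landauG (fine n M) 1 R) W₂) →
      rhoV n M R W ≤ (4 * Λ + 1 / 2) * (ScV n M R (landauG (fine n M) 1 R) W + nsqV M φ) := by
  intro φ W hW hmin
  have hd : (0 : ℝ) ≤ d := Nat.cast_nonneg d
  have hR1 : ∀ x μ, ‖R x μ‖ ≤ 1 := fun x μ => norm_le_one_of_mem_unitary (hU x μ)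
  -- the near-line rough Poincaré (leaf-10-g3): A = 64, B = 40
  have hPoinc := qWV_le_near_line_poincare n M hT' hR1 hw hsmallw hnear hγs
  have hsmall : 2 * 40 * (d * ((n : ℝ) ^ 2 * p)) ≤ 1 := by linarith
  -- (Går) and V-P for the Landau form on these carriers (leaf-09-g6)
  have hGar := fun W => garding_landau n M hU hp hP one_pos (Q := QvL n M T) hPoinc hsmall W
  have hPc := fun W => qWV_le_of_poincare_divControl n M hU hp hP (landauG_nonneg zero_le_one R) (divControl_landauG n M R one_pos (QvL n M T))
    (by norm_num : (0 : ℝ) ≤ 40) hPoinc hsmall W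
  set a : ℝ := d * ((n : ℝ) ^ 2 * p) with ha
  have ha0 : 0 ≤ a := by positivity
  have ha1 : a ≤ 1 / 80 := by linarith
  have hCGar : (0 : ℝ) ≤ 2 * (1 + 1) := by norm_num
  have hCGar' : (0 : ℝ) ≤ 2 * (0 + a * 64) := by positivity
  have h := hREG_rhoV_landau n M hU hp hP hT hΛ hCGar hCGar' hUBc hPc hGar φ W hW hmin
  -- the explicit constant is at most `4Λ + ½` in the plaquette class `80·d·(n²p) ≤ 1`
  set CP : ℝ := max (40 * (2 * (1 + (1 : ℝ)))) (64 + 40 * (2 * (0 + a * 64))) with hCPdef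
  have hCP : CP ≤ 160 := max_le (by norm_num) (by nlinarith)
  have hconst : 4 * Λ + 2 * d * ((n : ℝ) ^ 2 * p) * (2 * (1 + 1) + 2 * (0 + a * 64)) + 5 * (d : ℝ) ^ 2 * ((n : ℝ) ^ 2 * p) ^ 2 * CP
      ≤ 4 * Λ + 1 / 2 := by
    have e : 2 * d * ((n : ℝ) ^ 2 * p) * (2 * (1 + 1) + 2 * (0 + a * 64)) + 5 * (d : ℝ) ^ 2 * ((n : ℝ) ^ 2 * p) ^ 2 * CP
        = 8 * a + 256 * a ^ 2 + 5 * a ^ 2 * CP := by rw [ha]; ring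
    have h1 : a ^ 2 ≤ a * (1 / 80) := by nlinarith
    have h2 : a ^ 2 * CP ≤ a ^ 2 * 160 := mul_le_mul_of_nonneg_left hCP (sq_nonneg a)
    nlinarith [e, h1, h2]
  have hS0 : 0 ≤ ScV n M R (landauG (fine n M) 1 R) W + nsqV M φ :=
    add_nonneg (ScV_nonneg n M R (landauG_nonneg zero_le_one R) W) (nsqV_nonneg M φ)
  exact h.trans (mul_le_mul_of_nonneg_right hconst hS0)

end Summit.QuantumFields.BalabanUV.T4Continuum.VariationalVectorRegularityNear

end
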